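import Literature.NumberTheory.EllipticCurves.HeegnerPointsRationalityProofs
import HarnessLib

/-!
# Transport of the values of rational modular functions of level `Γ₀(N)` along `Aut(ℂ)`

Topic `NumberTheory/EllipticCurves` (the "canonical model of `X₀(N)` at CM points" chain).
Theorem-only file; no definition, no named fact.

Let `x ∈ K_N = ℂ(X₀(N))` be a modular function whose Laurent `q`-series is fixed coefficientwise
by a field automorphism `σ` of `ℂ` (`mapLaurent σ x = x`, e.g. `x` has rational `q`-expansion), let
`τ, τ' ∈ ℍ` be points whose level-`N` structures `(Λ_τ, Λ_{Nτ})`, `(Λ_{τ'}, Λ_{Nτ'})` correspond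
under `σ` (`LevelTransport N σ τ τ'`, `LevelStructureTransport.lean`), and suppose `x` is regular
at `τ` with value `c` (`v_τ(x − c) < 1`).  Then

* `LevelTransport.pointValuation_sub_lt_one` — **`x` is regular at `τ'` with value `σ(c)`**:
  `σ(x(τ)) = x(τ')`.

This is Shimura's reciprocity at the points of `Y₀(N)` for the functions of the canonical
`ℚ`-model `ℚ(X₀(N)) = {rational q-expansions}` (Shimura 1971, §6.2 Prop. 6.9, Thm. 6.31, §6.8), in
the transport form and with the proof of the tree's `HeegnerPointsRationalityProofs`
(`transport_weierstrassP_values`, there for the two coordinates of a modular parametrisation):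
the local representation `x·q(v) = p(v)` through the eight Eisenstein coordinate functions
(`ModularCurveLocalRingsAtPoints.exists_pointValuation_sub_div_lt_one`), the transport of the
coordinate values (`LevelTransport.apply_coordVal`) and of the representation
(`mul_aeval_map_eq`).  It is isolated here as the general statement, for use with Weber's
`γ₂(3τ) ∈ ℚ(X₀(9))` at CM points (Cox, *Primes of the form x² + ny²*, Thm. 12.2).

## References

* G. Shimura, *Introduction to the arithmetic theory of automorphic functions*, 1971, §6.2
  (Prop. 6.9), §6.8, Thm. 6.31. [ShimuraIATAF1971]
* H. Darmon, *Rational points on modular elliptic curves*, CBMS 101, 2004, Thm. 3.6–3.7. [Darmon2004]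
-/

noncomputable section

open Complex
open UpperHalfPlane hiding I
open scoped MatrixGroups ModularForm WithZero

namespace Literature.NumberTheory.EllipticCurves

open ModularForms

variable {N : ℕ} [NeZero N]

/-- **Transport of values of rational modular functions along `Aut(ℂ)`.**  If `σ` fixes the
`q`-series of `x ∈ K_N`, `LevelTransport N σ τ τ'`, and `x` is regular at `τ` with value `c`, then
`x` is regular at `τ'` with value `σ(c)`. [cite: ShimuraIATAF1971, §6.8 and Thm. 6.31]
[cite: Darmon2004, Thm. 3.7] -/
theorem LevelTransport.pointValuation_sub_lt_one {σ : ℂ ≃+* ℂ} {τ τ' : ℍ}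
    (hT : LevelTransport N σ τ τ') {x : modularFunctionField N}
    (hx : mapLaurent (σ : ℂ →+* ℂ) (x : LaurentSeries ℂ) = x) {c : ℂ}
    (hc : pointValuation (N := N) τ (x - algebraMap ℂ (modularFunctionField N) c) < 1) :
    pointValuation (N := N) τ' (x - algebraMap ℂ (modularFunctionField N) (σ c)) < 1 := by
  classical
  have hxmem : x ∈ (pointPlace (N := N) τ).toValuationSubring :=
    mem_pointPlace_of_pointValuation_sub_lt_one hc
  obtain ⟨p, q, hq, hpq, hval⟩ := exists_pointValuation_sub_div_lt_one τ hxmem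
  -- the value at `τ` is `p(v(τ))/q(v(τ))`
  have hc' := eq_of_pointValuation_sub_lt_one hc hval
  -- transport the representation and evaluate at `τ'`
  have hpqσ := mul_aeval_map_eq hx hpq
  have heval : ∀ r : CoordPoly, MvPolynomial.eval (fun i ↦ coordVal N i τ')
      (MvPolynomial.map (σ : ℂ →+* ℂ) r) = σ (MvPolynomial.eval (fun i ↦ coordVal N i τ) r) :=
    fun r ↦ eval_map_eq_of_apply_eq (fun i ↦ hT.apply_coordVal i) r
  have hqσ : MvPolynomial.eval (fun i ↦ coordVal N i τ') (MvPolynomial.map (σ : ℂ →+* ℂ) q) ≠ 0 := by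
    rw [heval]; exact (_root_.map_ne_zero σ).mpr hq
  have h := pointValuation_sub_div_lt_one_of_mul_aeval_eq τ' hqσ hpqσ
  rw [heval, heval, ← map_div₀, ← hc'] at h
  exact h

/-- The same, for `σ` fixing the level structure of `τ` itself: **`σ(x(τ)) = x(τ)`**, i.e. the value
`c` of `x` at `τ` is fixed by `σ` (values at `P_τ` being unique). [cite: ShimuraIATAF1971, §6.8 and Thm. 6.31] -/
theorem LevelTransport.apply_value_eq {σ : ℂ ≃+* ℂ} {τ : ℍ} (hT : LevelTransport N σ τ τ)
    {x : modularFunctionField N} (hx : mapLaurent (σ : ℂ →+* ℂ) (x : LaurentSeries ℂ) = x) {c : ℂ}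
    (hc : pointValuation (N := N) τ (x - algebraMap ℂ (modularFunctionField N) c) < 1) :
    σ c = c :=
  (eq_of_pointValuation_sub_lt_one hc (hT.pointValuation_sub_lt_one hx hc)).symm

end Literature.NumberTheory.EllipticCurves

end
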